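/-
Copyright: lit-balaban cell, Phase-2 proof seat p33 (reserve R4, second file: the periodic lattice and k > 1).  Reproduction of a
published argument; nothing is claimed beyond what the kernel checks below.
-/
import Mathlib
import Literature.MathematicalPhysics.QuantumFieldTheory.Balaban1983to89.B6Lemma24PrintedShape
import Literature.MathematicalPhysics.QuantumFieldTheory.BalabanImbrieJaffe1984to88.BIJ85NoZeroModes309Proof

/-!
# `BalabanImbrieJaffe1984to88.BIJ85NoZeroModes309KProof` — T. Bałaban, J. Imbrie, A. Jaffe, *Renormalization of the Higgs
model: minimizers, propagators and the stability of mean field theory*, Commun. Math. Phys. **97** (1985) 299–329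
[BalabanImbrieJaffe1985]: the «no zero modes» claim of Sect. 4.1, p. 309 — the periodic lattice T₁ and the case k > 1
(*"we leave out the details"*: the details supplied), PROVED

statement-level skeleton of published theorems with citation tags; proofs where landed; nothing here is a claim about
the Yang–Mills mass gap

PDF held: `paper:balaban1985-cmp97-bij-higgs-minimizers` (journal page = PDF page + 298); p. 309 [PDF 11] read on the held
text (claim, Q_k = (Q)^k, (4.1.2)), p. 302 [PDF 4] (periodic boundary conditions).

WHAT IS PRINTED (p. 309 [PDF 11], verbatim).  *"The averaging operator Q_k is the k-fold composition of the 1-step averaging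
operators Q for bond variables, Q_k = (Q)^k. It follows that Q_k is given by the formula (2.13), where L is replaced by L^k.
Finally, the axial gauge is fixed by the delta function δ_{k,Ax}(A) = Π_{j=0}^{k−1} δ_{Ax}(Q_jA). (4.1.2) The j-th factor in
the product acts on the L^jη = L^{j−k} lattice. It sets bond field averages Q_jA to zero on contours Γ_{yx} defined in the
L^jη lattice in the same way that the axial gauge was fixed in Sect. 3 on contours in the unit lattice. The reader may
wonder whether ∂ has zero modes on the subspace of gauge fields satisfying Q_kA = 0 and satisfying the axial gauge
condition. Such zero modes do not occur … A proof of this fact for k = 1 follows by … [see `BIJ85NoZeroModes309Proof`].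
Similar, elementary reasoning yields an inductive proof for k > 1, but we leave out the details."*

WHAT IS REPRODUCED.  SKELETON row `C1.Eq4.1.1-4.1.2` (r15-C1-38), CLAIM part, continued from the seat's first file
`BIJ85NoZeroModes309Proof` (k = 1, `noZeroModes_k1`): §1 `noZeroModes_k1_periodic` — the k = 1 claim on the paper's PERIODIC
unit lattice T₁ = (ℤ/Nℤ)^d (L ∣ N), read on integer representatives; §2 `coarse` (Q as a map of bond configurations, Q_k =
(Q)^k), `curl_coarse_eq_zero` (dA = 0 and the axial gauge of A give d(QA) = 0 — the one new geometric step: the unit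
plaquette at the common corner of four blocks consists of four connecting bonds), `noZeroModes` (the claim for EVERY k, by
the induction the paper indicates); §3 `iterate_coarse_eq_avg213` — *"It follows that Q_k is given by the formula (2.13),
where L is replaced by L^k"* PROVED (the composition (Q)^k IS the L^k-block average, normalisations included), so that the
hypothesis Q_kA = 0 reads either way (`iterate_coarse_eq_zero_iff`).  NOT reproduced: the functional integral (4.1.1) and
its convergence.

CARRIER: as in `BIJ85NoZeroModes309Proof` (the ℤ^d corner-block carrier of `…Balaban1983to89.B6BondElimination` /
`…B6TreeGaugePoincare`; dictionary there); §0 `avg213_eq_q1` records that (2.13) on this carrier is the tree's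
`B6Lemma24PrintedShape.q1` ((Q₁B)(c) of [B6] (2.125) = B5 (1.11)) — one formula, two papers' displays, no twin carrier.  The L^jη-lattices of (4.1.2) are each indexed by ℤ^d in their own lattice
units (the L-bond ⟨y, y + Le_μ⟩, y = Ln, of one lattice is the unit bond ⟨n, n + e_μ⟩ of the next), so that every Q_jA is
again a `Cfg d` and its axial gauge is the condition of Sect. 3 verbatim (`treeBonds L`).

Unit `lit-balaban-p33` (literature-prover-lit-balaban-p33-0), HOME `run/shared/lean/pub/lit-balaban/` (seat dir
`lit-balaban-p33/`), 2026-08-21.  Second file of the seat (the first is at the 400-line cap): announced in HOME/STATUS.md.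
-/

open Finset

namespace Literature.MathematicalPhysics.QuantumFieldTheory.BalabanImbrieJaffe1984to88.BIJ85NoZeroModes309KProof

open Literature.MathematicalPhysics.QuantumFieldTheory.Balaban1983to89
open B6Elimination (block mem_block)
open B6BondElimination (unitVec unitVec_apply add_unitVec_apply add_smul_unitVec_apply treeBonds)
open B6TreeGaugePoincare (Cfg curl)
open BIJ85NoZeroModes309Proof

noncomputable section

variable {d L : ℕ}

/-! ## §0  Dictionary: (2.13) on this carrier is the tree's (Q₁B)(c) of [B6] (2.125) = B5 (1.11) -/

/-- DICTIONARY (one formula, two papers' displays): the BIJ bond average (2.13) typed on this carrier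
(`BIJ85NoZeroModes309Proof.avg213`) IS `B6Lemma24PrintedShape.q1` — Bałaban's (Q₁B)(c) of *Propagators … II* (2.125) =
*Propagators … I* (1.11) — term by term. [cite: BalabanImbrieJaffe1985, (2.13) p.304] -/
theorem avg213_eq_q1 (L : ℕ) (A : Cfg d) (c : (Fin d → ℤ) × Fin d) :
    avg213 L A c = B6Lemma24PrintedShape.q1 L A c := by
  unfold avg213 B6Lemma24PrintedShape.q1 B6Lemma24PrintedShape.segSum
  rw [mul_sum]

/-! ## §1  The periodic unit lattice T₁ of the paper, read on integer representatives -/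

/-- The claim on the paper's periodic unit lattice (p. 302: *"T_a denotes a lattice with spacing a and periodic (toroidal)
boundary conditions"*), T₁ = (ℤ/Nℤ)^d with L ∣ N so that the blocks B(y), the trees T(y), the plaquettes and the L-lattice
bonds of T₁ are those of ℤ^d read modulo N: a configuration Ā on the bonds of T₁ whose N-periodic lift to the bonds of ℤ^d
satisfies dA = 0, the axial gauge (3.4) and QA = 0 ((2.13)) vanishes identically — `noZeroModes_k1` applied to the lift
(the divisibility L ∣ N is what makes the three lifted conditions the conditions of T₁; it is not needed for the
implication itself). [cite: BalabanImbrieJaffe1985, §4.1 p.309] -/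
theorem noZeroModes_k1_periodic (hL : 1 ≤ L) {N : ℕ} [NeZero N] (Ā : (Fin d → ZMod N) × Fin d → ℝ)
    (hcurl : ∀ (z : Fin d → ℤ) (j μ : Fin d), j < μ →
      curl (fun b : (Fin d → ℤ) × Fin d => Ā (fun i => ((b.1 i : ℤ) : ZMod N), b.2)) z j μ = 0)
    (hax : ∀ y : Fin d → ℤ, (∀ i, (L : ℤ) ∣ y i) → ∀ b ∈ treeBonds L y,
      (fun b : (Fin d → ℤ) × Fin d => Ā (fun i => ((b.1 i : ℤ) : ZMod N), b.2)) b = 0)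
    (hQ : ∀ y : Fin d → ℤ, (∀ i, (L : ℤ) ∣ y i) → ∀ μ : Fin d,
      avg213 L (fun b : (Fin d → ℤ) × Fin d => Ā (fun i => ((b.1 i : ℤ) : ZMod N), b.2)) (y, μ) = 0) :
    Ā = 0 := by
  have h := noZeroModes_k1 hL _ hcurl hax hQ
  funext ⟨w, μ⟩
  -- an integer representative of the torus site w
  have hw : (fun i => (((w i).cast : ℤ) : ZMod N)) = w := funext fun i => ZMod.intCast_zmod_cast (w i)
  have := congr_fun h (fun i => ((w i).cast : ℤ), μ)
  simp only [Pi.zero_apply] at this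
  rw [hw] at this
  exact this

/-! ## §2  k > 1: *"Similar, elementary reasoning yields an inductive proof for k > 1, but we leave out the details"* -/

/-- p. 309: *"The averaging operator Q_k is the k-fold composition of the 1-step averaging operators Q for bond variables,
Q_k = (Q)^k"* — the one-step average (2.13) as a map of bond configurations, the L-lattice bond ⟨y, y + Le_μ⟩, y = Ln,
being re-indexed by n ∈ ℤ^d (the L-lattice in its own lattice units), so that Q_k = `(coarse L)^[k]` (= the
L^k-block average (2.13), *"It follows that Q_k is given by the formula (2.13), where L is replaced by L^k"*:
`iterate_coarse_eq_avg213`, §3). [cite: BalabanImbrieJaffe1985, §4.1 p.309] -/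
def coarse (L : ℕ) (A : Cfg d) : Cfg d := fun b => avg213 L A ((L : ℤ) • b.1, b.2)

/-- Points of Lℤ^d written as L • n. [folklore] -/
private theorem dvd_smul_apply (n : Fin d → ℤ) (i : Fin d) : (L : ℤ) ∣ ((L : ℤ) • n) i :=
  ⟨n i, by simp⟩

/-- The corner point (…, y_j + L − 1, …, y_μ + L − 1, …) of B(y) and its membership facts. [folklore] -/
private theorem corner_mem (hL : 1 ≤ L) (y : Fin d → ℤ) (j μ : Fin d) :
    Function.update (Function.update y j (y j + L - 1)) μ (y μ + L - 1) ∈ block L y := by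
  rw [mem_block]
  intro i
  by_cases hi : i = μ
  · subst hi; simp only [Function.update_self]; constructor <;> omega
  · rw [Function.update_of_ne hi]
    by_cases hi' : i = j
    · subst hi'; simp only [Function.update_self]; constructor <;> omega
    · rw [Function.update_of_ne hi']; constructor <;> omega

/-- KEY STEP for k > 1: if A is in the axial gauge on every block and dA = 0, then the averaged field QA has vanishing
plaquette variables on the L-lattice — the unit plaquette at the common corner of the four blocks B(y), B(y + Le_j),
B(y + Le_μ), B(y + Le_j + Le_μ) consists of four connecting bonds, whose values are L·(QA) of the four L-bonds of the
L-plaquette (`avg213_eq_face`, `face_eq_base`). [cite: BalabanImbrieJaffe1985, §4.1 p.309] -/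
theorem curl_coarse_eq_zero (hL : 1 ≤ L) (A : Cfg d)
    (hcurl : ∀ (z : Fin d → ℤ) (j μ : Fin d), j < μ → curl A z j μ = 0)
    (hax : ∀ y : Fin d → ℤ, (∀ i, (L : ℤ) ∣ y i) → ∀ b ∈ treeBonds L y, A b = 0)
    (n : Fin d → ℤ) {j μ : Fin d} (hjμ : j < μ) : curl (coarse L A) n j μ = 0 := by
  have hne : j ≠ μ := hjμ.ne
  have hne' : μ ≠ j := hjμ.ne'
  set y : Fin d → ℤ := (L : ℤ) • n with hy_def
  have hy : ∀ i, (L : ℤ) ∣ y i := dvd_smul_apply n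
  have hyi : ∀ i, y i = (L : ℤ) * n i := fun i => by simp [hy_def]
  -- the corner point z* of B(y) in the directions j, μ
  set z : Fin d → ℤ := Function.update (Function.update y j (y j + L - 1)) μ (y μ + L - 1) with hz_def
  have hzμ : z μ = y μ + L - 1 := by simp [hz_def]
  have hzj : z j = y j + L - 1 := by simp [hz_def, Function.update_of_ne hne]
  have hzi : ∀ i, i ≠ j → i ≠ μ → z i = y i := fun i hij hiμ => by
    simp [hz_def, Function.update_of_ne hiμ, Function.update_of_ne hij]
  have hz : z ∈ block L y := corner_mem hL y j μ
  -- the neighbouring block corners y + Le_ν are again in Lℤ^d, and z* + e_ν lies in B(y + Le_ν)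
  have hdvd : ∀ ν i : Fin d, (L : ℤ) ∣ (y + (L : ℤ) • unitVec ν) i := fun ν i => by
    rw [add_smul_unitVec_apply, hyi]
    split_ifs
    · exact ⟨n i + 1, by ring⟩
    · exact ⟨n i, by ring⟩
  have hshift_mem : ∀ ν : Fin d, z ν = y ν + L - 1 → z + unitVec ν ∈ block L (y + (L : ℤ) • unitVec ν) := by
    intro ν hν
    rw [mem_block] at hz ⊢
    intro i
    rw [add_unitVec_apply, add_smul_unitVec_apply]
    have := hz i
    by_cases hi : i = ν
    · subst hi; simp only [if_true]; constructor <;> omega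
    · simp only [if_neg hi, add_zero]; exact this
  -- the four bonds of the unit plaquette at z* are connecting bonds of the four blocks
  -- (1) ⟨z, z + e_j⟩: j-face of B(y)
  have h1 : A (z, j) = A (Function.update y j (y j + L - 1), j) :=
    face_eq_base A hcurl hax hy hz (by omega)
  -- (2) ⟨z, z + e_μ⟩: μ-face of B(y)
  have h2 : A (z, μ) = A (Function.update y μ (y μ + L - 1), μ) :=
    face_eq_base A hcurl hax hy hz (by omega)
  -- (3) ⟨z + e_j, z + e_j + e_μ⟩: μ-face of B(y + Le_j)
  have hz3 : z + unitVec j ∈ block L (y + (L : ℤ) • unitVec j) := hshift_mem j hzj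
  have h3 : A (z + unitVec j, μ) =
      A (Function.update (y + (L : ℤ) • unitVec j) μ ((y + (L : ℤ) • unitVec j) μ + L - 1), μ) :=
    face_eq_base A hcurl hax (hdvd j) hz3
      (by rw [add_unitVec_apply, add_smul_unitVec_apply, if_neg hne', if_neg hne']; omega)
  -- (4) ⟨z + e_μ, z + e_μ + e_j⟩: j-face of B(y + Le_μ)
  have hz4 : z + unitVec μ ∈ block L (y + (L : ℤ) • unitVec μ) := hshift_mem μ hzμ
  have h4 : A (z + unitVec μ, j) =
      A (Function.update (y + (L : ℤ) • unitVec μ) j ((y + (L : ℤ) • unitVec μ) j + L - 1), j) :=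
    face_eq_base A hcurl hax (hdvd μ) hz4
      (by rw [add_unitVec_apply, add_smul_unitVec_apply, if_neg hne, if_neg hne]; omega)
  -- the averaged field on the four L-bonds of the L-plaquette at n
  have hL0 : (L : ℝ) ≠ 0 := by exact_mod_cast (by omega : L ≠ 0)
  have e1 : coarse L A (n, j) = ((L : ℝ))⁻¹ * A (Function.update y j (y j + L - 1), j) :=
    avg213_eq_face hL A hcurl hax hy j
  have e2 : coarse L A (n, μ) = ((L : ℝ))⁻¹ * A (Function.update y μ (y μ + L - 1), μ) :=
    avg213_eq_face hL A hcurl hax hy μ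
  have hshift : ∀ ν : Fin d, (L : ℤ) • (n + unitVec ν) = y + (L : ℤ) • unitVec ν := fun ν => by
    rw [smul_add, hy_def]
  have e3 : coarse L A (n + unitVec j, μ) =
      ((L : ℝ))⁻¹ * A (Function.update (y + (L : ℤ) • unitVec j) μ ((y + (L : ℤ) • unitVec j) μ + L - 1), μ) := by
    show avg213 L A ((L : ℤ) • (n + unitVec j), μ) = _
    rw [hshift]
    exact avg213_eq_face hL A hcurl hax (hdvd j) μ
  have e4 : coarse L A (n + unitVec μ, j) =
      ((L : ℝ))⁻¹ * A (Function.update (y + (L : ℤ) • unitVec μ) j ((y + (L : ℤ) • unitVec μ) j + L - 1), j) := by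
    show avg213 L A ((L : ℤ) • (n + unitVec μ), j) = _
    rw [hshift]
    exact avg213_eq_face hL A hcurl hax (hdvd μ) j
  -- dA = 0 on the unit plaquette at z*
  have hc := hcurl z j μ hjμ
  simp only [curl] at hc ⊢
  rw [e1, e2, e3, e4, ← h1, ← h2, ← h3, ← h4]
  have : ((L : ℝ))⁻¹ * (A (z, j) + A (z + unitVec j, μ) - A (z + unitVec μ, j) - A (z, μ)) = 0 := by
    rw [hc, mul_zero]
  linarith [this]

/-- **The claim of p. 309 for every k ≥ 0** (verbatim: *"Such zero modes do not occur … Similar, elementary reasoning yields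
an inductive proof for k > 1, but we leave out the details"*), the details supplied: with Q_k = (Q)^k (p. 309) and the
k-th axial gauge (4.1.2) *"δ_{k,Ax}(A) = Π_{j=0}^{k−1} δ_{Ax}(Q_jA). The j-th factor … sets bond field averages Q_jA to zero
on contours Γ_{yx} defined in the L^jη lattice in the same way that the axial gauge was fixed in Sect. 3"* — a
configuration A with dA = 0, Q_jA in the axial gauge of its lattice for every j < k, and Q_kA = 0 vanishes identically.
Induction on k: dA = 0 and the axial gauge of A give d(QA) = 0 (`curl_coarse_eq_zero`), the induction hypothesis gives
QA = 0, and the case k = 1 (`noZeroModes_k1`) gives A = 0. [cite: BalabanImbrieJaffe1985, (4.1.2) p.309] -/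
theorem noZeroModes (hL : 1 ≤ L) (k : ℕ) (A : Cfg d)
    (hcurl : ∀ (z : Fin d → ℤ) (j μ : Fin d), j < μ → curl A z j μ = 0)
    (hax : ∀ j < k, ∀ y : Fin d → ℤ, (∀ i, (L : ℤ) ∣ y i) → ∀ b ∈ treeBonds L y, (coarse L)^[j] A b = 0)
    (hQ : (coarse L)^[k] A = 0) : A = 0 := by
  induction k generalizing A with
  | zero => simpa using hQ
  | succ k ih =>
    have hax0 : ∀ y : Fin d → ℤ, (∀ i, (L : ℤ) ∣ y i) → ∀ b ∈ treeBonds L y, A b = 0 := by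
      simpa using hax 0 (Nat.zero_lt_succ k)
    -- QA satisfies the hypotheses at level k
    have hQA : coarse L A = 0 := by
      refine ih (coarse L A) (fun z j μ hjμ => curl_coarse_eq_zero hL A hcurl hax0 z hjμ) ?_ ?_
      · intro j hj y hy b hb
        have := hax (j + 1) (by omega) y hy b hb
        rwa [Function.iterate_succ_apply] at this
      · rwa [Function.iterate_succ_apply] at hQ
    -- hence QA = 0 on every L-bond, and the case k = 1 applies
    refine noZeroModes_k1 hL A hcurl hax0 fun y hy μ => ?_
    have hyL : (L : ℤ) • (fun i => y i / (L : ℤ)) = y := by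
      funext i
      obtain ⟨q, hq⟩ := hy i
      have hL0 : (L : ℤ) ≠ 0 := by exact_mod_cast (by omega : L ≠ 0)
      simp [hq, Int.mul_ediv_cancel_left _ hL0]
    have := congr_fun hQA (fun i => y i / (L : ℤ), μ)
    simp only [coarse, Pi.zero_apply] at this
    rwa [hyL] at this

/-! ## §3  *"It follows that Q_k is given by the formula (2.13), where L is replaced by L^k"* (p. 309) -/

/-- Translating a block: Σ over B(y + v) is Σ over B(y) of the translate. [folklore] -/
private theorem sum_block_add (L : ℕ) (y v : Fin d → ℤ) (g : (Fin d → ℤ) → ℝ) :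
    ∑ x ∈ block L (y + v), g x = ∑ x ∈ block L y, g (x + v) := by
  refine Finset.sum_nbij' (fun x => x - v) (fun x => x + v) ?_ ?_ ?_ ?_ ?_
  · intro x hx
    rw [mem_block] at hx ⊢
    intro i
    have := hx i
    simp only [Pi.add_apply, Pi.sub_apply] at this ⊢
    constructor <;> omega
  · intro x hx
    rw [mem_block] at hx ⊢
    intro i
    have := hx i
    simp only [Pi.add_apply] at this ⊢
    constructor <;> omega
  · intro x _; simp
  · intro x _; simp
  · intro x _; simp

/-- Splitting `range (a * b)` into `a` consecutive runs of length `b`. [folklore] -/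
private theorem sum_range_mul (a b : ℕ) (f : ℕ → ℝ) :
    ∑ i ∈ range a, ∑ j ∈ range b, f (b * i + j) = ∑ t ∈ range (a * b), f t := by
  induction a with
  | zero => simp
  | succ a ih =>
    rw [sum_range_succ, ih, Nat.succ_mul, sum_range_add]
    congr 1
    exact sum_congr rfl fun j _ => by rw [mul_comm]

/-- The blocks B_L(Lx′), x′ ∈ B_{L^k}(L^k n), partition B_{L^{k+1}}(L^{k+1} n): the sum over the big block is the
double sum. [folklore] -/
private theorem sum_block_pow_succ (hL : 1 ≤ L) (k : ℕ) (n : Fin d → ℤ) (g : (Fin d → ℤ) → ℝ) :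
    ∑ w ∈ block (L ^ (k + 1)) (((L : ℤ) ^ (k + 1)) • n), g w =
      ∑ x' ∈ block (L ^ k) (((L : ℤ) ^ k) • n), ∑ x ∈ block L ((L : ℤ) • x'), g x := by
  have hL0 : (0 : ℤ) < L := by exact_mod_cast hL
  have hLk : (0 : ℤ) < (L : ℤ) ^ k := pow_pos hL0 k
  -- the big block is the disjoint union of the small ones
  have hunion : block (L ^ (k + 1)) (((L : ℤ) ^ (k + 1)) • n) =
      (block (L ^ k) (((L : ℤ) ^ k) • n)).biUnion fun x' => block L ((L : ℤ) • x') := by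
    ext x
    simp only [Finset.mem_biUnion, mem_block, Pi.smul_apply, smul_eq_mul]
    push_cast
    constructor
    · intro hx
      refine ⟨fun i => x i / (L : ℤ), fun i => ?_, fun i => ?_⟩
      · have h1 := (hx i).1
        have h2 := (hx i).2
        constructor
        · exact Int.le_ediv_of_mul_le hL0 (by rw [pow_succ] at h1; linarith)
        · exact Int.ediv_lt_of_lt_mul hL0 (by rw [pow_succ] at h2; linarith)
      · exact ⟨Int.mul_ediv_self_le (ne_of_gt hL0), Int.lt_mul_ediv_self_add hL0⟩
    · rintro ⟨x', hx', hx⟩ i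
      have h1 := (hx' i).1
      have h2 := (hx' i).2
      have h3 := (hx i).1
      have h4 := (hx i).2
      have h5 : (L : ℤ) * x' i ≥ (L : ℤ) * ((L : ℤ) ^ k * n i) := mul_le_mul_of_nonneg_left h1 hL0.le
      have h6 : (L : ℤ) * x' i + L ≤ (L : ℤ) * ((L : ℤ) ^ k * n i + (L : ℤ) ^ k) := by
        have : x' i + 1 ≤ (L : ℤ) ^ k * n i + (L : ℤ) ^ k := by linarith
        nlinarith
      rw [pow_succ]
      constructor <;> nlinarith
  rw [hunion, Finset.sum_biUnion]
  -- pairwise disjointness of the small blocks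
  intro x' _ x'' _ hne
  refine Finset.disjoint_left.2 fun x hx hx2 => hne ?_
  funext i
  have h1 := (mem_block.1 hx i)
  have h2 := (mem_block.1 hx2 i)
  simp only [Pi.smul_apply, smul_eq_mul] at h1 h2
  have h3 : x' i < x'' i + 1 := by
    by_contra h
    push Not at h
    nlinarith [h1.1, h2.2]
  have h4 : x'' i < x' i + 1 := by
    by_contra h
    push Not at h
    nlinarith [h2.1, h1.2]
  omega

/-- p. 309, verbatim: *"It follows that Q_k is given by the formula (2.13), where L is replaced by L^k"* — the k-fold
composition (Q)^k IS the one-step average (2.13) with block size L^k (and contours of L^k unit bonds), normalisations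
included: (L^{−(d+1)})^k = (L^k)^{−(d+1)}. [cite: BalabanImbrieJaffe1985, §4.1 p.309] -/
theorem iterate_coarse_eq_avg213 (hL : 1 ≤ L) (k : ℕ) (A : Cfg d) (n : Fin d → ℤ) (μ : Fin d) :
    (coarse L)^[k] A (n, μ) = avg213 (L ^ k) A (((L : ℤ) ^ k) • n, μ) := by
  induction k generalizing A n with
  | zero =>
    simp only [Function.iterate_zero, id_eq, pow_zero, one_smul, avg213, Nat.cast_one, one_pow, inv_one, one_mul,
      range_one, sum_singleton, Nat.cast_zero, zero_smul, add_zero]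
    -- block 1 n = {n}
    have hb : block 1 n = {n} := by
      ext x
      simp only [mem_block, Nat.cast_one, Finset.mem_singleton]
      constructor
      · intro h; funext i; have := h i; omega
      · rintro rfl i; omega
    rw [hb, sum_singleton]
  | succ k ih =>
    rw [Function.iterate_succ_apply, ih (coarse L A) n]
    have hL0 : (L : ℝ) ≠ 0 := by exact_mod_cast (by omega : L ≠ 0)
    -- unfold the outer (2.13) with L^k and the inner one-step averages
    simp only [avg213, coarse]
    -- inner blocks: L • (x′ + s′e_μ) = L•x′ + (L s′) • e_μ, translate, and merge the two contour sums
    have inner : ∀ x' : Fin d → ℤ, ∑ s' ∈ range (L ^ k),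
        (((L : ℝ) ^ (d + 1))⁻¹ * ∑ x ∈ block L ((L : ℤ) • (x' + (s' : ℤ) • unitVec μ)),
          ∑ s ∈ range L, A (x + (s : ℤ) • unitVec μ, μ)) =
        ((L : ℝ) ^ (d + 1))⁻¹ * ∑ x ∈ block L ((L : ℤ) • x'),
          ∑ t ∈ range (L ^ k * L), A (x + (t : ℤ) • unitVec μ, μ) := by
      intro x'
      rw [← mul_sum]
      congr 1
      have step : ∀ s' ∈ range (L ^ k), ∑ x ∈ block L ((L : ℤ) • (x' + (s' : ℤ) • unitVec μ)),
          ∑ s ∈ range L, A (x + (s : ℤ) • unitVec μ, μ) =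
          ∑ x ∈ block L ((L : ℤ) • x'), ∑ s ∈ range L, A (x + ((L * s' + s : ℕ) : ℤ) • unitVec μ, μ) := by
        intro s' _
        rw [smul_add, sum_block_add]
        refine sum_congr rfl fun x _ => sum_congr rfl fun s _ => ?_
        congr 2
        rw [smul_smul, add_assoc, ← add_smul]
        push_cast
        ring_nf
      rw [sum_congr rfl step, sum_comm]
      refine sum_congr rfl fun x _ => ?_
      exact sum_range_mul (L ^ k) L (fun t => A (x + (t : ℤ) • unitVec μ, μ))
    rw [sum_congr rfl fun x' _ => inner x', ← mul_sum, ← sum_block_pow_succ hL k n, ← mul_assoc, ← pow_succ]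
    congr 1
    push_cast
    rw [← mul_inv, ← mul_pow, ← pow_succ]

/-- Hence the hypothesis «Q_kA = 0» of the claim may be read either way: (Q)^kA = 0 iff the L^k-block average (2.13)
of A vanishes on every bond of the L^k-lattice. [cite: BalabanImbrieJaffe1985, §4.1 p.309] -/
theorem iterate_coarse_eq_zero_iff (hL : 1 ≤ L) (k : ℕ) (A : Cfg d) :
    (coarse L)^[k] A = 0 ↔
      ∀ y : Fin d → ℤ, (∀ i, ((L : ℤ) ^ k) ∣ y i) → ∀ μ : Fin d, avg213 (L ^ k) A (y, μ) = 0 := by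
  constructor
  · intro h y hy μ
    have hyL : ((L : ℤ) ^ k) • (fun i => y i / (L : ℤ) ^ k) = y := by
      funext i
      obtain ⟨q, hq⟩ := hy i
      have hL0 : (L : ℤ) ^ k ≠ 0 := pow_ne_zero _ (by exact_mod_cast (by omega : L ≠ 0))
      simp [hq, Int.mul_ediv_cancel_left _ hL0]
    have := congr_fun h (fun i => y i / (L : ℤ) ^ k, μ)
    rw [iterate_coarse_eq_avg213 hL, hyL] at this
    simpa using this
  · intro h
    funext ⟨n, μ⟩
    rw [iterate_coarse_eq_avg213 hL]
    exact h _ (fun i => ⟨n i, by simp⟩) μ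

end

end Literature.MathematicalPhysics.QuantumFieldTheory.BalabanImbrieJaffe1984to88.BIJ85NoZeroModes309KProof
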